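import Summits.Ventures.HodgeRepro2.T5SU11LegendreOrthogonal
import Summits.Ventures.HodgeRepro2.T5SU11LegendreBound
import Summits.Ventures.HodgeRepro2.T5SU11LegendreChebyshev
import Summits.Ventures.HodgeRepro2.T5SU11LegendreRootLimit
import Summits.Ventures.HodgeRepro2.T5SU11LegendreRodrigues
import Summits.Ventures.HodgeRepro2.T5SU11LegendreLaplaceHeine
import Summits.Ventures.HodgeRepro2.T5SU11LegendreAtZero
import Summits.Ventures.HodgeRepro2.T5SU11LegendreHeineUniform

/-!
# The Legendre chapter, part II, in one place: rows 383–397 (except 394) indexed under uniform names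

A second summary module (the first, `T5SU11LegendreSummary`, covers rows 363–382): the headline statements of
rows 383–397 restated and proved by reference — orthogonality on `[−1, 1]` (383), `|P_n| ≤ 1` (385, 386), the
Chebyshev expansion and Heine on the circle (386), log-convexity in `n` on `[1, ∞)` (387), the ratio and root
limits (388, 389), Rodrigues (390), Stirling for the leading coefficient (391), the Laplace–Heine asymptotic
(393), the values at the origin with the alternating binomial identity (396), and the uniform two-sided
Laplace–Heine bound (397); the MGF of the phase at the even parameters (394) is imported separately. Nothing is claimed
about (N).

Blind lane: Mathlib + the HodgeRepro2 prefix only; no sorry; axioms ⊆ {propext, Classical.choice,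
Quot.sound}.
-/

namespace Summit.Ventures.HodgeRepro2.T5SU11LegendreSummaryII

open MeasureTheory Metric Set Filter Topology Finset Polynomial
open T5SU11Unimodular T5SU11Cartan T5BergmanCoefficient
  T5SU11SphericalFunction T5SU11SphericalLegendreAll T5SU11JacobiPhaseLawEven T5SU11SphericalAsymptotic
  T5SU11LegendreGenerating T5SU11LegendreHeine T5SU11LegendreOrthogonal T5SU11LegendreBound
  T5SU11LegendreChebyshev T5SU11LegendreLogConvex T5SU11LegendreRatioLimit T5SU11LegendreRootLimit
  T5SU11LegendreRodrigues T5SU11LegendreCentralBinomial T5SU11LegendreLaplaceHeine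
  T5SU11LegendreAtZero T5SU11LegendreHeineUniform
open scoped Real

/-- 383: orthogonality `∫_{−1}^{1} P_m P_n = 2δ_{mn}/(2n + 1)`. -/
theorem orthogonality (m n : ℕ) :
    ∫ x in (-1 : ℝ)..1, legP m x * legP n x = if m = n then 2 / (2 * (n : ℝ) + 1) else 0 :=
  integral_legP_mul_legP m n

/-- 385: `|P_n(x)| ≤ 1` on `[−1, 1]` (Sturm's function). -/
theorem bound_on_interval (n : ℕ) {x : ℝ} (hx : x ∈ Icc (-1 : ℝ) 1) : |legP n x| ≤ 1 :=
  abs_legP_le_one n hx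

/-- 386: the Chebyshev expansion `P_n = Σ_{k ≤ n} a_k a_{n−k} T_{2k−n}`. -/
theorem chebyshev_expansion (n : ℕ) (x : ℝ) :
    legP n x = ∑ k ∈ range (n + 1), binomHalf k * binomHalf (n - k) * (Chebyshev.T ℝ (2 * (k : ℤ) - n)).eval x :=
  legP_eq_sum_chebyshev n x

/-- 386: Heine on the circle `P_n(cos θ) = Σ_{k ≤ n} a_k a_{n−k} cos((2k − n)θ)`. -/
theorem heine_on_circle (n : ℕ) (θ : ℝ) :
    legP n (Real.cos θ)
      = ∑ k ∈ range (n + 1), binomHalf k * binomHalf (n - k) * Real.cos (((2 * (k : ℤ) - n : ℤ) : ℝ) * θ) :=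
  legP_cos_eq_sum n θ

/-- 387: log-convexity `P_{n+1}(x)² ≤ P_n(x) P_{n+2}(x)` on `[1, ∞)`. -/
theorem log_convex (n : ℕ) {x : ℝ} (hx : 1 ≤ x) : legP (n + 1) x ^ 2 ≤ legP n x * legP (n + 2) x := by
  letI : MeasurableSpace Circle := borel Circle
  haveI : BorelSpace Circle := ⟨rfl⟩
  exact legP_sq_le_mul n hx

/-- 388: the ratio limit `P_{n+1}(x)/P_n(x) → ρ(x)`. -/
theorem ratio_limit {x : ℝ} (hx : 1 ≤ x) :
    Tendsto (fun n : ℕ => legP (n + 1) x / legP n x) atTop (𝓝 (rho x)) :=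
  tendsto_legP_ratio hx

/-- 389: the root limit `P_n(x)^{1/n} → ρ(x)`. -/
theorem root_limit {x : ℝ} (hx : 1 ≤ x) :
    Tendsto (fun n : ℕ => legP n x ^ ((n : ℝ)⁻¹)) atTop (𝓝 (rho x)) :=
  tendsto_legP_rpow_inv hx

/-- 390: Rodrigues' formula `2ⁿ n! · legPoly n = Dⁿ (X² − 1)ⁿ`. -/
theorem rodrigues_formula (n : ℕ) :
    C ((2 : ℝ) ^ n * n.factorial) * legPoly n = derivative^[n] ((X ^ 2 - 1) ^ n) :=
  rodrigues n

/-- 391: `√n · c(−2n) → 1/√π` (Stirling). -/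
theorem cfun_asymptotic :
    Tendsto (fun n : ℕ => Real.sqrt n * cfun (-(2 * (n : ℝ)))) atTop (𝓝 (1 / Real.sqrt Real.pi)) :=
  tendsto_sqrt_mul_cfun

/-- 393: the Laplace–Heine asymptotic `√n e^{−2nt} P_n(cosh 2t) → 1/√(π(1 − e^{−4t}))`, `t > 0`. -/
theorem laplace_heine {t : ℝ} (ht : 0 < t) :
    Tendsto (fun n : ℕ => Real.sqrt n * (Real.exp (-(2 * (n : ℝ)) * t) * legP n (Real.cosh (2 * t)))) atTop
      (𝓝 (1 / Real.sqrt (Real.pi * (1 - Real.exp (-(4 * t)))))) :=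
  tendsto_sqrt_mul_exp_neg_mul_legP_cosh ht

/-- 396: `P_{2m}(0) = (−1)^m C(2m,m)/4^m`, `P_{2m+1}(0) = 0`. -/
theorem values_at_zero (m : ℕ) : legP (2 * m) 0 = (-1) ^ m * binomHalf m ∧ legP (2 * m + 1) 0 = 0 :=
  legP_zero_pair m

/-- 396: `Σ_{k ≤ 2m} (−1)^k C(2k,k) C(4m−2k, 2m−k) = 4^m C(2m,m)`. -/
theorem alternating_binomial_identity (m : ℕ) :
    ∑ k ∈ range (2 * m + 1), (-1 : ℤ) ^ k * ((2 * k).choose k * (2 * (2 * m - k)).choose (2 * m - k) : ℤ)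
      = 4 ^ m * (2 * m).choose m :=
  sum_alternating_centralBinom m

section measure

variable [MeasurableSpace Circle] [BorelSpace Circle]

/-- 387: `φ_{2n+4}(g)² ≤ φ_{2n+2}(g) φ_{2n+6}(g)`. -/
theorem sph_log_convex (n : ℕ) (g : SU11) :
    sph (2 * ((n : ℝ) + 1) + 2) g ^ 2 ≤ sph (2 * (n : ℝ) + 2) g * sph (2 * ((n : ℝ) + 2) + 2) g :=
  sph_even_sq_le_mul n g

/-- 388: `φ_{2n+4}(g)/φ_{2n+2}(g) → (|a| + |b|)²`. -/
theorem sph_ratio_limit (g : SU11) :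
    Tendsto (fun n : ℕ => sph (2 * ((n : ℝ) + 1) + 2) g / sph (2 * (n : ℝ) + 2) g) atTop
      (𝓝 ((‖mat g 0 0‖ + ‖mat g 0 1‖) ^ 2)) :=
  tendsto_sph_even_ratio g

/-- 393: `√n e^{−2nt} φ_{2n+2}(a_t) → 1/√(π(1 − e^{−4t}))`, `t > 0`. -/
theorem sph_laplace_heine {t : ℝ} (ht : 0 < t) :
    Tendsto (fun n : ℕ => Real.sqrt n * (Real.exp (-(2 * (n : ℝ)) * t) * sph (2 * (n : ℝ) + 2) (hyp t))) atTop
      (𝓝 (1 / Real.sqrt (Real.pi * (1 - Real.exp (-(4 * t)))))) :=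
  tendsto_sqrt_mul_exp_neg_mul_sph_even_hyp ht

/-- 397: `c(−2n) ≤ e^{−2nt} φ_{2n+2}(a_t) ≤ c(−2n)(1 + 2√n/(e^{4t} − 1))` for `n ≥ 1`, `t > 0`. -/
theorem sph_uniform_bound {n : ℕ} (hn : 1 ≤ n) {t : ℝ} (ht : 0 < t) :
    cfun (-(2 * (n : ℝ))) ≤ Real.exp (-(2 * (n : ℝ)) * t) * sph (2 * (n : ℝ) + 2) (hyp t)
      ∧ Real.exp (-(2 * (n : ℝ)) * t) * sph (2 * (n : ℝ) + 2) (hyp t)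
          ≤ cfun (-(2 * (n : ℝ))) * (1 + 2 * Real.sqrt n / (Real.exp (4 * t) - 1)) :=
  exp_neg_mul_sph_even_hyp_le_uniform hn ht

end measure

end Summit.Ventures.HodgeRepro2.T5SU11LegendreSummaryII
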